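import Summits.SmoothPoincare4.SmoothPoincare4.Theorems.SullivanDualWitnessChargeSubstubFar
import Summits.SmoothPoincare4.SmoothPoincare4.Theorems.SullivanDualWitnessChargeFlatChart

/-!
# The far flat lines form a smooth family (FARFAM)

Crux `WitnessCharge` (stmt-SmoothPoincare4-7824), line `Sketch`, skeleton v7, stub `helper_farFamily`.

Over the far intercepts `{ε'⁻¹ < ‖b‖}` the far flat lines are the slices `ξ ↦ Φ.symm (ξ, b)` of the
inverse of the flat end chart `Φ` (`substub_flatChart`, a diffeomorphism of the punctured
`ε'`-chart-ball onto the standard end `{ε'⁻¹ < ‖realify q‖}` of `ℂ × ℂ`). We take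
`F b ξ := Φ.symm (ξ, b)` (total; junk off the far set):

* for `ε'⁻¹ < ‖b‖` the point `(ξ, b)` lies in `Φ.target` (`‖b‖ ≤ ‖realify (ξ, b)‖`), and the formula
  for `Φ.symm` on the target identifies `F b` with `farLine b`, a pencil member by
  `isPencilMember_farLine`;
* `(b, ξ) ↦ F b ξ = Φ.symm ∘ swap` is `C^∞` on `{far} × ℂ` since `Φ.symm` is `C^∞` on the open target
  and the swap is linear;
* the differential is injective: `(swap ∘ Φ) ∘ (Φ.symm ∘ swap) = id` near every point of
  `{far} × ℂ`, so by the chain rule `D(swap ∘ Φ) ∘ D(Φ.symm ∘ swap) = id`.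
-/

noncomputable section

set_option linter.dupNamespace false

open scoped Manifold ContDiff Topology
open Set Filter Literature.Geometry.Kaehler Literature.Geometry.Symplectic
  Literature.Topology.FourManifolds

namespace Summit.SmoothPoincare4.SmoothPoincare4.Theorems.WitnessCharge.PencilIncompleteness

/-- **FARFAM — the far flat lines form a smooth family with injective differential over the far
intercepts.** Over `{ε'⁻¹ < ‖b‖}` the far lines `(b, ξ) ↦ Φ.symm (ξ, b)` (`Φ` the flat end chart
`substub_flatChart`) are pencil members (`isPencilMember_farLine`), jointly `C^∞` (`Φ.symm` is `C^∞`
on the open target, which contains `(ξ, b)`), with injective differential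
(`D(swap ∘ Φ) ∘ D(Φ.symm ∘ swap) = id`). -/
theorem helper_farFamily :
    ∀ (S : HomotopySphere 4) (p : S.carrier)
      (J : ∀ x : punctured p, TangentSpace (𝓡 4) x →L[ℝ] TangentSpace (𝓡 4) x) (ε' : ℝ),
      0 < ε' →
      Metric.closedBall (extChartAt (𝓡 4) p p) ε' ⊆ (extChartAt (𝓡 4) p).target →
      (∀ x : punctured p, InPuncturedChartBall p ε' x →
        ∀ (v : TangentSpace (𝓡 4) x) (b : EuclideanSpace ℝ (Fin 4)),
          inner ℝ (fderiv ℝ inversion (extChartAt (𝓡 4) p x.1 - extChartAt (𝓡 4) p p)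
            (mfderiv (𝓡 4) 𝓘(ℝ, EuclideanSpace ℝ (Fin 4))
              (fun z : punctured p => extChartAt (𝓡 4) p z.1) x (J x v))) b
          = stdSymplecticForm (fderiv ℝ inversion (extChartAt (𝓡 4) p x.1 - extChartAt (𝓡 4) p p)
            (mfderiv (𝓡 4) 𝓘(ℝ, EuclideanSpace ℝ (Fin 4))
              (fun z : punctured p => extChartAt (𝓡 4) p z.1) x v)) b) →
      ∃ F : ℂ → ℂ → punctured p,
          ((∀ b ∈ {b : ℂ | ε'⁻¹ < ‖b‖}, IsPencilMember J (F b) b) ∧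
            ContMDiffOn 𝓘(ℝ, ℂ × ℂ) (𝓡 4) ∞ (fun q : ℂ × ℂ => F q.1 q.2) (({b : ℂ | ε'⁻¹ < ‖b‖}) ×ˢ (univ : Set ℂ)) ∧
            (∀ q : ℂ × ℂ, q.1 ∈ {b : ℂ | ε'⁻¹ < ‖b‖} →
              Function.Injective (mfderiv 𝓘(ℝ, ℂ × ℂ) (𝓡 4) (fun q : ℂ × ℂ => F q.1 q.2) q))) := by
  intro S p J ε' hε' hball hJstd
  obtain ⟨Φ, -, htgt, -, hsymm, hΦs, hΦsymm_s, -⟩ := substub_flatChart S p ε' hε' hball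
  -- far points `(ξ, b)` lie in the target of the flat chart
  have hmem : ∀ ξ b : ℂ, ε'⁻¹ < ‖b‖ → (ξ, b) ∈ Φ.target := fun ξ b hb => by
    rw [htgt]
    exact hb.trans_le (norm_le_norm_realify ξ b)
  -- the swap of the two factors is smooth
  have hswapC : ContDiff ℝ ∞ (fun q : ℂ × ℂ => (q.2, q.1)) := contDiff_snd.prodMk contDiff_fst
  have hswap : ContMDiff 𝓘(ℝ, ℂ × ℂ) 𝓘(ℝ, ℂ × ℂ) ∞ (fun q : ℂ × ℂ => (q.2, q.1)) :=
    hswapC.contMDiff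
  -- the far set `{far} × ℂ` is open
  have hopen : IsOpen (({b : ℂ | ε'⁻¹ < ‖b‖}) ×ˢ (univ : Set ℂ)) :=
    (isOpen_lt continuous_const continuous_norm).prod isOpen_univ
  -- joint smoothness of the family `(b, ξ) ↦ Φ.symm (ξ, b)` on the far set
  have hGs : ContMDiffOn 𝓘(ℝ, ℂ × ℂ) (𝓡 4) ∞ (fun q : ℂ × ℂ => Φ.symm (q.2, q.1))
      (({b : ℂ | ε'⁻¹ < ‖b‖}) ×ˢ (univ : Set ℂ)) :=
    hΦsymm_s.comp hswap.contMDiffOn (fun q hq => hmem q.2 q.1 hq.1)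
  refine ⟨fun b ξ => Φ.symm (ξ, b), fun b hb => ?_, hGs, fun q hq => ?_⟩
  · -- the slice at a far intercept is the far flat line, a pencil member
    have hF : (fun ξ : ℂ => Φ.symm (ξ, b)) = farLine hε' hball hb := by
      funext ξ
      apply Subtype.ext
      rw [hsymm (ξ, b) (hmem ξ b hb)]
      rfl
    show IsPencilMember J (fun ξ : ℂ => Φ.symm (ξ, b)) b
    rw [hF]
    exact isPencilMember_farLine hε' hball hb J hJstd
  · -- injectivity of the differential: `(swap ∘ Φ) ∘ (Φ.symm ∘ swap) = id` near `q`
    have hqt : (q.2, q.1) ∈ Φ.target := hmem q.2 q.1 hq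
    have hx : Φ.symm (q.2, q.1) ∈ Φ.source := Φ.map_target hqt
    have hqm : q ∈ ({b : ℂ | ε'⁻¹ < ‖b‖}) ×ˢ (univ : Set ℂ) := ⟨hq, mem_univ _⟩
    have hGd : MDifferentiableAt 𝓘(ℝ, ℂ × ℂ) (𝓡 4) (fun q : ℂ × ℂ => Φ.symm (q.2, q.1)) q :=
      ((hGs q hqm).contMDiffAt (hopen.mem_nhds hqm)).mdifferentiableAt (by simp)
    have hΦat : ContMDiffAt (𝓡 4) 𝓘(ℝ, ℂ × ℂ) ∞ Φ (Φ.symm (q.2, q.1)) :=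
      (hΦs _ hx).contMDiffAt (Φ.open_source.mem_nhds hx)
    have hHd : MDifferentiableAt (𝓡 4) 𝓘(ℝ, ℂ × ℂ)
        ((fun q : ℂ × ℂ => (q.2, q.1)) ∘ Φ) (Φ.symm (q.2, q.1)) :=
      (hswap.contMDiffAt.comp (Φ.symm (q.2, q.1)) hΦat).mdifferentiableAt (by simp)
    have heq : (((fun q : ℂ × ℂ => (q.2, q.1)) ∘ Φ) ∘ (fun q : ℂ × ℂ => Φ.symm (q.2, q.1)))
        =ᶠ[𝓝 q] id := by
      filter_upwards [hopen.mem_nhds hqm] with q' hq'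
      simp only [Function.comp_apply, id]
      rw [Φ.right_inv (hmem q'.2 q'.1 hq'.1)]
    have h1 : HasMFDerivAt 𝓘(ℝ, ℂ × ℂ) 𝓘(ℝ, ℂ × ℂ)
        (((fun q : ℂ × ℂ => (q.2, q.1)) ∘ Φ) ∘ (fun q : ℂ × ℂ => Φ.symm (q.2, q.1))) q
        ((mfderiv (𝓡 4) 𝓘(ℝ, ℂ × ℂ) ((fun q : ℂ × ℂ => (q.2, q.1)) ∘ Φ) (Φ.symm (q.2, q.1))).comp
          (mfderiv 𝓘(ℝ, ℂ × ℂ) (𝓡 4) (fun q : ℂ × ℂ => Φ.symm (q.2, q.1)) q)) :=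
      HasMFDerivAt.comp q (g := (fun q : ℂ × ℂ => (q.2, q.1)) ∘ Φ)
        (f := fun q : ℂ × ℂ => Φ.symm (q.2, q.1)) hHd.hasMFDerivAt hGd.hasMFDerivAt
    have h2 : HasMFDerivAt 𝓘(ℝ, ℂ × ℂ) 𝓘(ℝ, ℂ × ℂ)
        (((fun q : ℂ × ℂ => (q.2, q.1)) ∘ Φ) ∘ (fun q : ℂ × ℂ => Φ.symm (q.2, q.1))) q
        (ContinuousLinearMap.id ℝ (TangentSpace 𝓘(ℝ, ℂ × ℂ) q)) :=
      (hasMFDerivAt_id (I := 𝓘(ℝ, ℂ × ℂ)) q).congr_of_eventuallyEq heq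
    have h3 := hasMFDerivAt_unique h1 h2
    have h4 : Function.LeftInverse
        (mfderiv (𝓡 4) 𝓘(ℝ, ℂ × ℂ) ((fun q : ℂ × ℂ => (q.2, q.1)) ∘ Φ) (Φ.symm (q.2, q.1)))
        (mfderiv 𝓘(ℝ, ℂ × ℂ) (𝓡 4) (fun q : ℂ × ℂ => Φ.symm (q.2, q.1)) q) :=
      fun v => ContinuousLinearMap.ext_iff.1 h3 v
    exact h4.injective

end Summit.SmoothPoincare4.SmoothPoincare4.Theorems.WitnessCharge.PencilIncompleteness
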